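import Literature.Barriers.AtomisticToContinuum.HalfFillingDischarges
import Literature.Barriers.AtomisticToContinuum.HalfFillingReflectionPositivityProofs
import Literature.MathematicalPhysics.QuantumLattice.XYZGroundStateOrderIntegral
import Literature.MathematicalPhysics.QuantumLattice.HardCoreBosonGroundStateUnique
import Literature.MathematicalPhysics.QuantumLattice.FinDimSpectrumGibbsLimitProofs
import Literature.MathematicalPhysics.QuantumLattice.SpinChainsAkltCorrelationProofs
import Literature.MathematicalPhysics.QuantumLattice.XXZPlanarCorrelationPowerLawDecay
import Literature.MathematicalPhysics.QuantumLattice.HardCoreBosonCondensateWaveFunction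
import HarnessLib

/-!
# Hard-core lattice bosons at half filling in a staggered field: BOSE–EINSTEIN CONDENSATION IN THE
# GROUND STATE in every dimension `d ≥ 2` — in particular in `d = 2`, where there is none at `T > 0`

Aizenman–Lieb–Seiringer–Solovej–Yngvason, *Bose–Einstein quantum phase transition in an optical
lattice model*, Phys. Rev. A **70** (2004) 023612 (= [LSSY2005] Ch. 11), §2: "We shall prove that
for `ϱ = 1/2` and `d ≥ 3` the thermal equilibrium state of (2.1) shows Bose–Einstein condensation
for small `λ` and low temperature `T`, while for large `λ` or `T` the condensation disappears.
**For `d = 2` this is true only in the ground state.**" The tree holds the `d ≥ 3`, `T > 0` theorem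
(Theorem 1: `Literature.Barriers.AtomisticToContinuum.HalfFillingReflectionPositivity_holds`,
`hardCoreLatticeGas_lro_liminf_ge`), its `β = ∞` form in the printed `d ≥ 3` window
(`hardCoreLatticeGas_groundState_lro_eventually_ge`, constant `c_d = ∫dp/E_p`, infinite in `d = 2`),
and the `d ≤ 2`, `T > 0` complement (`MerminWagner.hardCoreLatticeGas_not_hasEvenTorusLRO`: NO
condensation at any positive temperature, Koma–Tasaki 1992). THIS FILE proves the remaining printed
claim, the GROUND-STATE condensation in `d = 2` (and, by the same argument, in every `d ≥ 2`) for
the hard-core lattice gas `H = -Σ_{⟨xy⟩}(S¹_xS¹_y + S²_xS²_y) + λΣ_x[½ + (-1)^x S³_x]`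
(`hardCoreLatticeGas d L λ`, [LSSY2005] (11.2)) on the even tori `(ℤ/2kℤ)^d` at small staggered
field `λ ≥ 0` — for `λ = 0` this is Kennedy–Lieb–Shastry's theorem "the spin-½ XY model has LRO in
the ground state for all `d ≥ 2`" ([KLS1988PRL]; the tree's `kennedy_lieb_shastry_xy_ground_holds`).

The proof is the printed one read at `β = ∞` BEFORE `Λ ↗ ℤ^d`: the tree's finite-volume
Kennedy–Lieb–Shastry inequality at positive temperature for this model
(`hc_ineq7` with the discharged facts (Aᵀ) infrared bound after the Falk–Bruch transfer, (Bᵀ) Kubo,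
(Cᵀ) sum rule; `HalfFillingThermalKLS.lean`, `HalfFillingReflectionPositivityProofs.lean`),

  `e₁(β) ≤ |Λ|⁻¹ĝ¹₀(β) + ½ (e₁(β) + λ/d)^{1/2} R_L + T_L/(2β)`,

is passed to the limit `β → ∞` on a FIXED torus (`Matrix.tendsto_gibbsState_atTop_holds`: Gibbs
states converge to the tracial ground state; here the ground state is unique,
`HardCoreBoson.hasUniqueGroundState_hardCoreLatticeGas`), where the thermal term `T_L/(2β)` — the
only place where `d ≥ 3` was needed (`T_L → c_d`) — disappears; what is left is controlled by the
Kennedy–Lieb–Shastry Riemann sums `R_L` alone, which the tree bounds in EVERY `d ≥ 2`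
(`klsRiemannSum_eventually_le`: `limsup R_L ≤ 0.69 < 1/√2`; in `d = 2` the sharper
`klsRiemannSum_two_eventually_le`: `R_L ≤ 0.651`).

## Main statements

* §1 `hcGroundCorr`, `hardCoreGroundODLRO` — the ground-state two-point functions
  `Re ω_∞(S^α_xS^α_y)` and `γ_∞(x,y) = Re ω_∞(S¹_xS¹_y + S²_xS²_y)` (the `β = ∞` twins of `hcCorr`,
  `hardCoreODLRO`), their identification as `β → ∞` limits (`tendsto_hcCorr_atTop`,
  `tendsto_hardCoreODLRO_atTop`) and as expectations in the unique ground vector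
  (`hcGroundCorr_eq_re_dotProduct`).
* §2 `hardCoreLatticeGas_ground_kls_ineq` — [KLS1988PRL] eq. (7) AT `T = 0` WITH THE STAGGERED FIELD:
  `e₁ ≤ |Λ|⁻²Σ_{x,y}Re ω_∞(S¹_xS¹_y) + ½(e₁ + λ/d)^{1/2} R_L` on every even torus `L = 2k ≥ 4`, every
  `d ≥ 1`, `λ ≥ 0`; `hardCoreLatticeGas_ground_bondCorr_ge` — `e₁ ≥ 1/8 - λ/(4d)`.
* §3 `hardCoreLatticeGas_ground_lro_ge_of_klsRiemannSum` — THE FINITE-VOLUME FLOOR from the certified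
  Riemann sum: `|Λ|⁻²Σ_{x,y}Re ω_∞(S¹_xS¹_y) ≥ (1/8 - λ/(4d)) - ½R_L(1/8 + 3λ/(4d))^{1/2}` whenever
  `λ/d ≤ 1/4`, `R_L ≤ 1` (and the ground-vector form `…_dotProduct_ge_of_klsRiemannSum`).
* §4 **`hardCoreLatticeGas_groundState_bec`** — for every `d ≥ 2` there is `λ₀ > 0` such that for
  `0 ≤ λ < λ₀` the ground states have off-diagonal long-range order,
  `HasEvenTorusLRO (fun L x y => hardCoreGroundODLRO L λ x y)`;
  **`hardCoreLatticeGas_groundState_bec_two`** — `d = 2`, `0 ≤ λ ≤ 1/40`: eventually in `L = 2k`,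
  `|Λ|⁻²Σ_{x,y}γ_∞(x,y) ≥ 1/250`, hence `HasEvenTorusLRO`; the ground-vector form
  `hardCoreLatticeGas_groundState_lro_ge_two` (`Σ_{x,y}⟨Φ,(S¹_xS¹_y + S²_xS²_y)Φ⟩ ≥ |Λ|²/500`).
* §5 **`hardCoreLatticeGas_two_groundState_order_and_thermal_disorder`** — the `d = 2` dichotomy of
  the source's sentence: for `0 ≤ λ ≤ 1/40` the ground states have LRO while NO Gibbs state
  (`β ≥ 0`) has (`MerminWagner.hardCoreLatticeGas_not_hasEvenTorusLRO`).
* §6 Theorem 1, SECOND CLAUSE, at `T = 0` (the `β → ∞` limits of the symmetry, row-sum, per-mode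
  infrared and Plancherel lemmas of `HardCoreBosonCondensateWaveFunction.lean`; the `O(L²)/β` Duhamel
  term disappears and the threshold becomes `M_L = (L/4)√(d + |λ|/2) = O(L)`, small against `|Λ|` in
  EVERY `d ≥ 2`): `hardCoreGroundODLRO_eq_kernel`, `re_torusFourier_hardCoreGroundODLRO_le`,
  `hardCoreGroundODLRO_eigenvector_const` (an eigenvector of `γ_∞` with eigenvalue `> M_L` is
  constant), `…_eigenvalue_eq_zeroMode`, `…_eigenvector_norm_sum_sq`, and
  **`hardCoreLatticeGas_groundState_condensateWaveFunction_const_two`** (`d = 2`, `0 ≤ λ ≤ 1/40`,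
  large tori: the constants are eigenvectors with eigenvalue `ĝ_∞(0) ≥ |Λ|/250 > M_L`, and every
  eigenvector with eigenvalue `> M_L` is constant — exactly one macroscopic eigenvalue, simple,
  constant condensate wave function, EXACTLY in finite volume);
  §7 **`hardCoreLatticeGas_groundState_condensateWaveFunction_const`** — the same in EVERY `d ≥ 2` for
  `0 ≤ λ < λ₀(d)` (threshold `O(|Λ|^{1/d})` against a zero mode `≥ m|Λ|`).

All statements are PROVED (no named fact, no `sorry`; axioms `propext`, `Classical.choice`,
`Quot.sound`). Not claimed: the optimal window in `λ` (the printed `d ≥ 3` window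
`λ² < c_d⁻² - d(d+1)/4` uses the Watson integral and does not apply in `d = 2`); anything at `T > 0`
in `d = 2` (false: no LRO); `d = 1` (no LRO even at `T = 0`, not treated); infinite-volume
(torus-limit state) forms.

## References

* [AizenmanEtAl2004] M. Aizenman, E. H. Lieb, R. Seiringer, J. P. Solovej, J. Yngvason, Phys. Rev.
  A **70** (2004) 023612 = arXiv:cond-mat/0403240: §2 (the sentence quoted above), Theorem 1,
  eqs. (3.1)–(3.13).
* [LSSY2005] E. H. Lieb, R. Seiringer, J. P. Solovej, J. Yngvason, *The Mathematics of the Bose Gas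
  and its Condensation* (2005), Ch. 11, (11.2), (11.8), (11.20)–(11.27).
* [KLS1988PRL] T. Kennedy, E. H. Lieb, B. S. Shastry, Phys. Rev. Lett. **61** (1988) 2582,
  Theorem and eqs. (3)–(8) (the `λ = 0`, `T = 0` case, all `d ≥ 2`).
* [DLS1978] F. J. Dyson, E. H. Lieb, B. Simon, J. Stat. Phys. **18** (1978) 335, Thms. 3.1–3.2
  (the transfer `coth`), Thm. 4.2.
* [KomaTasakiPRL1992] T. Koma, H. Tasaki, Phys. Rev. Lett. **68** (1992) 3248 (no LRO in `d ≤ 2` at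
  `T > 0`).
-/

noncomputable section

open Filter Topology Matrix Complex Finset
open Literature.MathematicalPhysics.QuantumLattice Literature.MathematicalPhysics.QuantumLattice.SpinOperators
open Literature.Probability.LatticeModels Literature.Barriers.AtomisticToContinuum
open Literature.Barriers.AtomisticToContinuum.BoseGas
open Literature.MathematicalPhysics.QuantumLattice.XYOrderProofs
open scoped ComplexOrder

namespace Literature.MathematicalPhysics.QuantumLattice

variable {d : ℕ}

/-! ### §1 The ground-state two-point functions and the limit `β → ∞` on a fixed torus -/

section GroundState

/-- The GROUND-STATE `α–α` correlation `Re ω_∞(S^α_x S^α_y)` of `hardCoreLatticeGas d L λ`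
(`ω_∞` = the tracial ground state `Matrix.groundStateFunctional`; junk `0` at `L = 0`) — the
`β = ∞` twin of `hcCorr`. [cite: AizenmanEtAl2004, §2 and Theorem 1] [cite: LSSY2005, Ch. 11 §11.3] -/
def hcGroundCorr (α : Fin 3) (L : ℕ) (lam : ℝ) (x y : TorusSite d L) : ℝ :=
  if hL : L = 0 then 0
  else
    haveI : NeZero L := ⟨hL⟩
    ((hardCoreLatticeGas d L lam).groundStateFunctional (siteSpin 1 x α * siteSpin 1 y α)).re

/-- The GROUND-STATE one-particle density matrix `γ_∞(x,y) = Re ω_∞(S¹_xS¹_y + S²_xS²_y) = ω_∞(a†_x a_y)`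
(`x ≠ y`) of the hard-core lattice gas — the `β = ∞` twin of `hardCoreODLRO`.
[cite: AizenmanEtAl2004, §2 and Theorem 1] [cite: LSSY2005, Ch. 11 §11.3 (after (11.27))] -/
def hardCoreGroundODLRO (L : ℕ) (lam : ℝ) (x y : TorusSite d L) : ℝ :=
  hcGroundCorr 0 L lam x y + hcGroundCorr 1 L lam x y

/-- Junk side. [folklore] -/
@[simp] private theorem hcGroundCorr_zero_side (α : Fin 3) (lam : ℝ) (x y : TorusSite d 0) :
    hcGroundCorr α 0 lam x y = 0 := by
  simp [hcGroundCorr]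

/-- Unfolding on a genuine torus. [cite: LSSY2005, Ch. 11 §11.3] -/
theorem hcGroundCorr_of_neZero (α : Fin 3) (L : ℕ) [NeZero L] (lam : ℝ) (x y : TorusSite d L) :
    hcGroundCorr α L lam x y =
      ((hardCoreLatticeGas d L lam).groundStateFunctional (siteSpin 1 x α * siteSpin 1 y α)).re := by
  simp [hcGroundCorr, NeZero.ne L]

/-- **The thermal correlations converge to the ground-state correlations as `β → ∞`** on a fixed
torus (Gibbs states of a finite-dimensional Hamiltonian converge to the tracial ground state).
[cite: LSSY2005, Ch. 11 §11.3] -/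
theorem tendsto_hcCorr_atTop (α : Fin 3) (L : ℕ) [NeZero L] (lam : ℝ) (x y : TorusSite d L) :
    Tendsto (fun β : ℝ => hcCorr α β L lam x y) atTop (𝓝 (hcGroundCorr α L lam x y)) := by
  have hH := hardCoreLatticeGas_isHermitian d L lam
  simp_rw [hcCorr_of_neZero, hcGroundCorr_of_neZero, thermalCorr]
  exact (Complex.continuous_re.tendsto _).comp (Matrix.tendsto_gibbsState_atTop_holds hH _)

/-- `γ_β(x,y) → γ_∞(x,y)` as `β → ∞` on a fixed torus. [cite: LSSY2005, Ch. 11 §11.3] -/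
theorem tendsto_hardCoreODLRO_atTop (L : ℕ) [NeZero L] (lam : ℝ) (x y : TorusSite d L) :
    Tendsto (fun β : ℝ => hardCoreODLRO β L lam x y) atTop (𝓝 (hardCoreGroundODLRO L lam x y)) := by
  simp_rw [hardCoreODLRO_eq_add, hardCoreGroundODLRO]
  exact (tendsto_hcCorr_atTop 0 L lam x y).add (tendsto_hcCorr_atTop 1 L lam x y)

/-- `1 ↔ 2` symmetry in the ground state: `Re ω_∞(S²_xS²_y) = Re ω_∞(S¹_xS¹_y)` (limit of the thermal
identity (Sᵀ)). [cite: LSSY2005, Ch. 11 §11.1] -/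
theorem hcGroundCorr_one_eq_zero (L : ℕ) (lam : ℝ) (x y : TorusSite d L) :
    hcGroundCorr 1 L lam x y = hcGroundCorr 0 L lam x y := by
  rcases Nat.eq_zero_or_pos L with rfl | hL
  · simp
  · haveI : NeZero L := ⟨hL.ne'⟩
    refine tendsto_nhds_unique (tendsto_hcCorr_atTop 1 L lam x y) ?_
    have h : (fun β : ℝ => hcCorr 1 β L lam x y) = fun β => hcCorr 0 β L lam x y :=
      funext fun β => hc_corr_one_eq_zero_holds d L β lam x y
    rw [h]
    exact tendsto_hcCorr_atTop 0 L lam x y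

/-- `γ_∞ = 2 Re ω_∞(S¹S¹)`. [cite: LSSY2005, Ch. 11 §11.3] -/
theorem hardCoreGroundODLRO_eq_two_mul (L : ℕ) (lam : ℝ) (x y : TorusSite d L) :
    hardCoreGroundODLRO L lam x y = 2 * hcGroundCorr 0 L lam x y := by
  rw [hardCoreGroundODLRO, hcGroundCorr_one_eq_zero, two_mul]

/-- A priori bound `|Re ω_∞(S^α_xS^α_y)| ≤ ¼` (limit of (Tᵀ); spin ½: `‖S^α_xS^α_y‖ ≤ ¼`).
[cite: LSSY2005, Ch. 11 §11.1 (the spin-½ operators of (11.2))] -/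
theorem abs_hcGroundCorr_le (α : Fin 3) (L : ℕ) (lam : ℝ) (x y : TorusSite d L) :
    |hcGroundCorr α L lam x y| ≤ 1 / 4 := by
  rcases Nat.eq_zero_or_pos L with rfl | hL
  · simp
  · haveI : NeZero L := ⟨hL.ne'⟩
    exact le_of_tendsto ((continuous_abs.tendsto _).comp (tendsto_hcCorr_atTop α L lam x y))
      (Filter.Eventually.of_forall fun β => hc_corr_abs_le_holds α d L β lam x y)

/-- A priori bound `|γ_∞(x,y)| ≤ ½` (spin ½). [cite: LSSY2005, Ch. 11 §11.1 (the spin-½ operators of (11.2))] -/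
theorem abs_hardCoreGroundODLRO_le (L : ℕ) (lam : ℝ) (x y : TorusSite d L) :
    |hardCoreGroundODLRO L lam x y| ≤ 1 / 2 := by
  rw [hardCoreGroundODLRO]
  have h0 := abs_hcGroundCorr_le 0 L lam x y
  have h1 := abs_hcGroundCorr_le 1 L lam x y
  calc |hcGroundCorr 0 L lam x y + hcGroundCorr 1 L lam x y|
      ≤ |hcGroundCorr 0 L lam x y| + |hcGroundCorr 1 L lam x y| := abs_add_le _ _
    _ ≤ 1 / 2 := by linarith

/-- **The ground state is unique, so `ω_∞` is the vector state of any normalised ground vector**: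
`Re ω_∞(S^α_xS^α_y) = Re⟨Φ, S^α_xS^α_y Φ⟩` (`d ≥ 1`, even side).
[cite: AizenmanEtAl2004, Appendix A (uniqueness of the ground state)] -/
theorem hcGroundCorr_eq_re_dotProduct (hd : 0 < d) {L : ℕ} [NeZero L] (hL : Even L) (lam : ℝ)
    {Φ : TensorIndex (TorusSite d L) 2 → ℂ} (hΦ : Φ ∈ (hardCoreLatticeGas d L lam).groundSpace)
    (hΦ1 : star Φ ⬝ᵥ Φ = 1) (α : Fin 3) (x y : TorusSite d L) :
    hcGroundCorr α L lam x y = (star Φ ⬝ᵥ ((siteSpin 1 x α * siteSpin 1 y α) *ᵥ Φ)).re := by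
  have hU := HardCoreBoson.hasUniqueGroundState_hardCoreLatticeGas hd hL lam
  have hΦ0 : Φ ≠ 0 := by
    intro h
    rw [h, dotProduct_zero] at hΦ1
    exact zero_ne_one hΦ1
  rw [hcGroundCorr_of_neZero, groundStateFunctional_eq_of_hasUniqueGroundState hU hΦ hΦ0, hΦ1, div_one]

/-- The ground-vector form of `γ_∞`: `γ_∞(x,y) = Re⟨Φ,(S¹_xS¹_y + S²_xS²_y)Φ⟩`.
[cite: AizenmanEtAl2004, Theorem 1 and Appendix A] -/
theorem hardCoreGroundODLRO_eq_re_dotProduct (hd : 0 < d) {L : ℕ} [NeZero L] (hL : Even L) (lam : ℝ)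
    {Φ : TensorIndex (TorusSite d L) 2 → ℂ} (hΦ : Φ ∈ (hardCoreLatticeGas d L lam).groundSpace)
    (hΦ1 : star Φ ⬝ᵥ Φ = 1) (x y : TorusSite d L) :
    hardCoreGroundODLRO L lam x y =
      (star Φ ⬝ᵥ ((siteSpin 1 x 0 * siteSpin 1 y 0 + siteSpin 1 x 1 * siteSpin 1 y 1) *ᵥ Φ)).re := by
  rw [hardCoreGroundODLRO, hcGroundCorr_eq_re_dotProduct hd hL lam hΦ hΦ1,
    hcGroundCorr_eq_re_dotProduct hd hL lam hΦ hΦ1, Matrix.add_mulVec, dotProduct_add, Complex.add_re]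

/-- The ground-state bond correlation `e₁(∞) = (d|Λ|)⁻¹ Σ_x Σᵢ Re ω_∞(S¹_xS¹_{x+eᵢ})` is the limit of
the thermal `e₁(β)` (`hcBondCorr`). [cite: KLS1988PRL, eq. (3)] -/
theorem tendsto_hcBondCorr_atTop (L : ℕ) [NeZero L] (lam : ℝ) :
    Tendsto (fun β : ℝ => hcBondCorr (d := d) 0 β L lam) atTop
      (𝓝 ((∑ x : TorusSite d L, ∑ i : Fin d, hcGroundCorr 0 L lam x (x + Pi.single i 1)) /
        ((d : ℝ) * (L : ℝ) ^ d))) := by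
  simp_rw [hcBondCorr_of_neZero]
  exact (tendsto_finsetSum _ fun x _ => tendsto_finsetSum _ fun i _ =>
    tendsto_hcCorr_atTop 0 L lam _ _).div_const _

/-- The zero-momentum structure factor `ĝ¹₀(∞) = |Λ|⁻¹Σ_{x,y}Re ω_∞(S¹_xS¹_y)` is the limit of the
thermal one. [cite: LSSY2005, Ch. 11 (after (11.27))] -/
theorem tendsto_hcStructureFactor_zero_atTop (L : ℕ) [NeZero L] (lam : ℝ) :
    Tendsto (fun β : ℝ => hcStructureFactor 0 β L lam (0 : TorusSite d L)) atTop
      (𝓝 ((∑ x : TorusSite d L, ∑ y : TorusSite d L, hcGroundCorr 0 L lam x y) / (L : ℝ) ^ d)) := by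
  simp_rw [hcStructureFactor_zero_momentum]
  exact (tendsto_finsetSum _ fun x _ => tendsto_finsetSum _ fun y _ =>
    tendsto_hcCorr_atTop 0 L lam x y).div_const _

end GroundState

/-! ### §2 Kennedy–Lieb–Shastry's inequality (7) at `T = 0` with the staggered field -/

section KLS

/-- **[KLS1988PRL] eq. (7) AT ZERO TEMPERATURE, WITH THE STAGGERED FIELD, IN FINITE VOLUME.** On the
even torus of side `L = 2k ≥ 4`, for every `d ≥ 1` and `λ ≥ 0`, the ground state of
`hardCoreLatticeGas d L λ` satisfies
`e₁ ≤ |Λ|⁻²Σ_{x,y}Re ω_∞(S¹_xS¹_y) + ½ (e₁ + λ/d)^{1/2} R_L`,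
`e₁ = (d|Λ|)⁻¹Σ_xΣᵢ Re ω_∞(S¹_xS¹_{x+eᵢ})`, `R_L` the punctured Riemann sum of the KLS integrand
(`klsRiemannSum d L`) — the `β → ∞` limit of the tree's thermal inequality `hc_ineq7` (infrared bound
from reflection positivity / Gaussian domination and the Falk–Bruch transfer, Kubo's inequality, the
sum rule), in which the thermal term `T_L/(2β)` vanishes.
[cite: KLS1988PRL, eqs. (4)–(7)] [cite: LSSY2005, Ch. 11 (11.8), (11.20)–(11.23)] [cite: DLS1978, Thms. 3.1–3.2, Thm. 4.2] -/
theorem hardCoreLatticeGas_ground_kls_ineq (hd : 1 ≤ d) {k : ℕ} [NeZero (2 * k)] (hk : 2 ≤ k)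
    {lam : ℝ} (hlam : 0 ≤ lam) :
    (∑ x : TorusSite d (2 * k), ∑ i : Fin d, hcGroundCorr 0 (2 * k) lam x (x + Pi.single i 1)) /
        ((d : ℝ) * (((2 * k : ℕ) : ℝ)) ^ d) ≤
      (∑ x : TorusSite d (2 * k), ∑ y : TorusSite d (2 * k), hcGroundCorr 0 (2 * k) lam x y) /
          (((2 * k : ℕ) : ℝ)) ^ d / (((2 * k : ℕ) : ℝ)) ^ d +
        1 / 2 * Real.sqrt ((∑ x : TorusSite d (2 * k), ∑ i : Fin d,
            hcGroundCorr 0 (2 * k) lam x (x + Pi.single i 1)) / ((d : ℝ) * (((2 * k : ℕ) : ℝ)) ^ d) +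
            lam / d) * klsRiemannSum d (2 * k) := by
  set e : ℝ → ℝ := fun β => hcBondCorr (d := d) 0 β (2 * k) lam with he
  set g : ℝ → ℝ := fun β => hcStructureFactor 0 β (2 * k) lam (0 : TorusSite d (2 * k)) with hg
  set R : ℝ := klsRiemannSum d (2 * k) with hR
  set T : ℝ := torusGreen (0 : TorusSite d (2 * k)) with hT
  set N : ℝ := (((2 * k : ℕ) : ℝ)) ^ d with hN
  set e₁ : ℝ := (∑ x : TorusSite d (2 * k), ∑ i : Fin d,
    hcGroundCorr 0 (2 * k) lam x (x + Pi.single i 1)) / ((d : ℝ) * N) with he₁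
  set g₀ : ℝ := (∑ x : TorusSite d (2 * k), ∑ y : TorusSite d (2 * k),
    hcGroundCorr 0 (2 * k) lam x y) / N with hg₀
  -- the thermal inequality for every `β > 0`
  have h7 : ∀ β : ℝ, 0 < β → e β ≤ g β / N + 1 / 2 * Real.sqrt (e β + lam / d) * R + 1 / (2 * β) * T :=
    fun β hβ => hc_ineq7 hc_infraredBound_thermal_holds hc_kubo_thermal_holds hc_sumRule_holds hd hk hβ hlam
  -- limits of both sides
  have he_lim : Tendsto e atTop (𝓝 e₁) := tendsto_hcBondCorr_atTop (d := d) (2 * k) lam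
  have hg_lim : Tendsto g atTop (𝓝 g₀) := tendsto_hcStructureFactor_zero_atTop (d := d) (2 * k) lam
  have hT_lim : Tendsto (fun β : ℝ => 1 / (2 * β) * T) atTop (𝓝 0) := by
    have h2 : Tendsto (fun β : ℝ => 2 * β) atTop atTop := Tendsto.const_mul_atTop two_pos tendsto_id
    have h := (tendsto_const_nhds (x := (1 : ℝ))).div_atTop h2
    simpa using h.mul_const T
  have hrhs : Tendsto (fun β : ℝ => g β / N + 1 / 2 * Real.sqrt (e β + lam / d) * R + 1 / (2 * β) * T)
      atTop (𝓝 (g₀ / N + 1 / 2 * Real.sqrt (e₁ + lam / d) * R + 0)) :=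
    ((hg_lim.div_const N).add
      ((tendsto_const_nhds.mul (he_lim.add tendsto_const_nhds).sqrt).mul tendsto_const_nhds)).add hT_lim
  rw [add_zero] at hrhs
  exact le_of_tendsto_of_tendsto he_lim hrhs (Filter.eventually_atTop.2 ⟨1, fun β hβ => h7 β (by linarith)⟩)

/-- **The ground-state energy bound `e₁ ≥ 1/8 - λ/(4d)`** (`d ≥ 1`, `L ≥ 3`, `λ ≥ 0`): the limit
`β → ∞` of (Dᵀ) `e₁(β) ≥ 1/8 - λ/(4d) - log 2/(2dβ)` (variational bound with the product state along
the 1-axis; "a simple variational argument"). [cite: KLS1988PRL, after eq. (8)] [cite: LSSY2005, Ch. 11 (11.24)] -/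
theorem hardCoreLatticeGas_ground_bondCorr_ge (hd : 1 ≤ d) {L : ℕ} [NeZero L] (hL : 3 ≤ L)
    {lam : ℝ} (hlam : 0 ≤ lam) :
    1 / 8 - lam / (4 * d) ≤
      (∑ x : TorusSite d L, ∑ i : Fin d, hcGroundCorr 0 L lam x (x + Pi.single i 1)) /
        ((d : ℝ) * (L : ℝ) ^ d) := by
  have hD : ∀ β : ℝ, 0 < β →
      1 / 8 - lam / (4 * d) - Real.log 2 / (2 * d * β) ≤ hcBondCorr (d := d) 0 β L lam :=
    fun β hβ => hc_bondCorr_lower_thermal_holds d hd L hL β lam hβ hlam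
  have hlhs : Tendsto (fun β : ℝ => 1 / 8 - lam / (4 * d) - Real.log 2 / (2 * d * β)) atTop
      (𝓝 (1 / 8 - lam / (4 * d) - 0)) := by
    refine tendsto_const_nhds.sub ?_
    have h2 : Tendsto (fun β : ℝ => 2 * (d : ℝ) * β) atTop atTop :=
      Tendsto.const_mul_atTop (by positivity) tendsto_id
    exact (tendsto_const_nhds (x := Real.log 2)).div_atTop h2
  rw [sub_zero] at hlhs
  exact le_of_tendsto_of_tendsto hlhs (tendsto_hcBondCorr_atTop (d := d) L lam)
    (Filter.eventually_atTop.2 ⟨1, fun β hβ => hD β (by linarith)⟩)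

end KLS

/-! ### §3 The finite-volume floor from the certified Riemann sum -/

section Floor

/-- **THE FINITE-VOLUME FLOOR ON THE GROUND-STATE ORDER PARAMETER FROM ONE CERTIFIED NUMBER.** On the
even torus `L = 2k ≥ 4`, `d ≥ 1`, for `0 ≤ λ`, `λ/d ≤ 1/4` and `R_L ≤ 1` (`R_L = klsRiemannSum d L`,
a finite certified sum),
`|Λ|⁻²Σ_{x,y}Re ω_∞(S¹_xS¹_y) ≥ (1/8 - λ/(4d)) - ½ R_L (1/8 + 3λ/(4d))^{1/2}`:
§2's inequality and energy bound combined through the monotonicity of `t ↦ t - ½R√(t + λ/d)` on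
`t + λ/d ≥ R²/16` (`kls_monotone_step`), exactly as in the thermal assembly.
[cite: KLS1988PRL, eqs. (7)–(8)] [cite: LSSY2005, Ch. 11 (11.26)] -/
theorem hardCoreLatticeGas_ground_lro_ge_of_klsRiemannSum (hd : 1 ≤ d) {k : ℕ} [NeZero (2 * k)]
    (hk : 2 ≤ k) {lam : ℝ} (hlam : 0 ≤ lam) (hlamd : lam / d ≤ 1 / 4)
    (hR : klsRiemannSum d (2 * k) ≤ 1) :
    (1 / 8 - lam / (4 * d)) - 1 / 2 * Real.sqrt (1 / 8 + 3 / 4 * (lam / d)) * klsRiemannSum d (2 * k) ≤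
      (∑ x : TorusSite d (2 * k), ∑ y : TorusSite d (2 * k), hcGroundCorr 0 (2 * k) lam x y) /
        ((((2 * k : ℕ) : ℝ)) ^ d) ^ 2 := by
  have hd0 : (0 : ℝ) < d := by exact_mod_cast (show 0 < d by omega)
  set R : ℝ := klsRiemannSum d (2 * k) with hR_def
  set N : ℝ := (((2 * k : ℕ) : ℝ)) ^ d with hN
  have hN0 : 0 < N := by positivity
  set e₁ : ℝ := (∑ x : TorusSite d (2 * k), ∑ i : Fin d,
    hcGroundCorr 0 (2 * k) lam x (x + Pi.single i 1)) / ((d : ℝ) * N) with he₁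
  set G : ℝ := (∑ x : TorusSite d (2 * k), ∑ y : TorusSite d (2 * k),
    hcGroundCorr 0 (2 * k) lam x y) / N ^ 2 with hG
  have h7 := hardCoreLatticeGas_ground_kls_ineq hd hk hlam
  have hGN : (∑ x : TorusSite d (2 * k), ∑ y : TorusSite d (2 * k),
      hcGroundCorr 0 (2 * k) lam x y) / N / N = G := by
    rw [hG, div_div, sq]
  rw [hGN] at h7
  have hR0 : 0 ≤ R := klsRiemannSum_nonneg _ _
  -- (D) at `T = 0`
  have hDk : 1 / 8 - lam / (4 * d) ≤ e₁ :=
    hardCoreLatticeGas_ground_bondCorr_ge hd (L := 2 * k) (by omega) hlam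
  have hlam4 : lam / (4 * d) = (lam / d) / 4 := by rw [div_div, mul_comm]
  rw [hlam4] at hDk ⊢
  have hlamd0 : 0 ≤ lam / d := by positivity
  obtain ⟨s, hs_def⟩ : ∃ s : ℝ, s = 1 / 8 - lam / d / 4 := ⟨_, rfl⟩
  have hse : s ≤ e₁ := by rw [hs_def]; exact hDk
  have hs16 : 1 / 16 ≤ s := by rw [hs_def]; linarith
  have hsa : 0 ≤ s + lam / d := by linarith
  -- the monotone step on `t ↦ t - ½ R √(t + λ/d)`
  have hR4 : R ≤ 4 * Real.sqrt (s + lam / d) := by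
    have h14 : (1 / 4 : ℝ) ≤ Real.sqrt (s + lam / d) := by
      rw [Real.le_sqrt (by norm_num) hsa]; linarith
    linarith
  have hmono := kls_monotone_step hsa (show s + lam / d ≤ e₁ + lam / d by linarith) hR4
  have hsx : s + lam / d = 1 / 8 + 3 / 4 * (lam / d) := by rw [hs_def]; ring
  rw [← hs_def, ← hsx]
  linarith [h7, hmono]

/-- The ground-vector form of the floor: for every normalised ground vector `Φ` of
`hardCoreLatticeGas d (2k) λ` (`d ≥ 1`, `k ≥ 2`, `0 ≤ λ`, `λ/d ≤ 1/4`, `R_L ≤ 1`),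
`Σ_{x,y}Re⟨Φ,(S¹_xS¹_y + S²_xS²_y)Φ⟩ ≥ 2|Λ|²[(1/8 - λ/(4d)) - ½R_L(1/8 + 3λ/(4d))^{1/2}]`.
[cite: KLS1988PRL, eqs. (7)–(8)] [cite: AizenmanEtAl2004, Theorem 1] -/
theorem hardCoreLatticeGas_ground_dotProduct_ge_of_klsRiemannSum (hd : 1 ≤ d) {k : ℕ}
    [NeZero (2 * k)] (hk : 2 ≤ k) {lam : ℝ} (hlam : 0 ≤ lam) (hlamd : lam / d ≤ 1 / 4)
    (hR : klsRiemannSum d (2 * k) ≤ 1) {Φ : TensorIndex (TorusSite d (2 * k)) 2 → ℂ}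
    (hΦ : Φ ∈ (hardCoreLatticeGas d (2 * k) lam).groundSpace) (hΦ1 : star Φ ⬝ᵥ Φ = 1) :
    2 * ((((2 * k : ℕ) : ℝ)) ^ d) ^ 2 *
        ((1 / 8 - lam / (4 * d)) - 1 / 2 * Real.sqrt (1 / 8 + 3 / 4 * (lam / d)) * klsRiemannSum d (2 * k)) ≤
      ∑ x : TorusSite d (2 * k), ∑ y : TorusSite d (2 * k),
        (star Φ ⬝ᵥ ((siteSpin 1 x 0 * siteSpin 1 y 0 + siteSpin 1 x 1 * siteSpin 1 y 1) *ᵥ Φ)).re := by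
  have h := hardCoreLatticeGas_ground_lro_ge_of_klsRiemannSum hd hk hlam hlamd hR
  have hN0 : (0 : ℝ) < ((((2 * k : ℕ) : ℝ)) ^ d) ^ 2 := by positivity
  rw [le_div_iff₀ hN0] at h
  have hsum : ∑ x : TorusSite d (2 * k), ∑ y : TorusSite d (2 * k),
      (star Φ ⬝ᵥ ((siteSpin 1 x 0 * siteSpin 1 y 0 + siteSpin 1 x 1 * siteSpin 1 y 1) *ᵥ Φ)).re =
      2 * ∑ x : TorusSite d (2 * k), ∑ y : TorusSite d (2 * k), hcGroundCorr 0 (2 * k) lam x y := by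
    rw [Finset.mul_sum]
    refine Finset.sum_congr rfl fun x _ => ?_
    rw [Finset.mul_sum]
    refine Finset.sum_congr rfl fun y _ => ?_
    rw [← hardCoreGroundODLRO_eq_re_dotProduct (by omega) (even_two_mul k) lam hΦ hΦ1,
      hardCoreGroundODLRO_eq_two_mul]
  rw [hsum]
  linarith

end Floor

/-! ### §4 Ground-state Bose–Einstein condensation: every `d ≥ 2`, and the explicit `d = 2` window -/

section BEC

/-- The LRO sequence of the ground-state density matrix on the torus of side `L = 2k ≥ 2` equals
`2|Λ|⁻²Σ_{x,y}Re ω_∞(S¹_xS¹_y)`. [cite: LSSY2005, Ch. 11 (after (11.27))] -/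
theorem hardCoreGround_lroSeq_eq (lam : ℝ) (k : ℕ) [NeZero (2 * k)] :
    (∑ x ∈ halfOpenBox d (2 * k), ∑ y ∈ halfOpenBox d (2 * k),
        torusPullback (fun L x y => hardCoreGroundODLRO (d := d) L lam x y) (2 * k) x y) /
        ((halfOpenBox d (2 * k)).card : ℝ) ^ 2 =
      2 * ((∑ x : TorusSite d (2 * k), ∑ y : TorusSite d (2 * k), hcGroundCorr 0 (2 * k) lam x y) /
        ((((2 * k : ℕ) : ℝ)) ^ d) ^ 2) := by
  rw [sum_halfOpenBox_torusPullback, card_halfOpenBox]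
  simp only [hardCoreGroundODLRO_eq_two_mul, ← mul_sum]
  push_cast
  ring

/-- Boundedness of the ground-state LRO sequence: `|Λ|⁻²Σ_{x,y}γ_∞ ≤ ½` (needed only for the
`liminf`). [cite: LSSY2005, Ch. 11 §11.3 (after (11.27))] -/
theorem hardCoreGround_lroSeq_le (lam : ℝ) (k : ℕ) :
    (∑ x ∈ halfOpenBox d (2 * k), ∑ y ∈ halfOpenBox d (2 * k),
        torusPullback (fun L x y => hardCoreGroundODLRO (d := d) L lam x y) (2 * k) x y) /
        ((halfOpenBox d (2 * k)).card : ℝ) ^ 2 ≤ 1 / 2 := by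
  refine div_le_of_le_mul₀ (by positivity) (by norm_num) ?_
  have hb : ∀ x y : Site d, torusPullback (fun L x y => hardCoreGroundODLRO (d := d) L lam x y)
      (2 * k) x y ≤ 1 / 2 := by
    intro x y
    rw [torusPullback_apply]
    exact le_of_abs_le (abs_hardCoreGroundODLRO_le _ _ _ _)
  calc ∑ x ∈ halfOpenBox d (2 * k), ∑ y ∈ halfOpenBox d (2 * k),
        torusPullback (fun L x y => hardCoreGroundODLRO (d := d) L lam x y) (2 * k) x y
      ≤ ∑ x ∈ halfOpenBox d (2 * k), ∑ y ∈ halfOpenBox d (2 * k), (1 / 2 : ℝ) :=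
        sum_le_sum fun x _ => sum_le_sum fun y _ => hb x y
    _ = 1 / 2 * ((halfOpenBox d (2 * k)).card : ℝ) ^ 2 := by
        simp only [sum_const, nsmul_eq_mul]
        ring

/-- **GROUND-STATE BOSE–EINSTEIN CONDENSATION IN EVERY DIMENSION `d ≥ 2`** (Theorem 1 of the source
at `T = 0`, including the `d = 2` case announced in its §2; at `λ = 0` Kennedy–Lieb–Shastry's XY
theorem): for every `d ≥ 2` there is `λ₀ > 0` (here `λ₀ = min (d/8) (d m₀/2)`, `m₀ = (1 - √2ρ)/8 > 0`
with `ρ < 1/√2` an eventual bound of the KLS Riemann sums) such that for `0 ≤ λ < λ₀` the ground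
states of the hard-core lattice gas on the even tori have off-diagonal long-range order;
quantitatively, eventually in `L = 2k`, `|Λ|⁻²Σ_{x,y}γ_∞(x,y) ≥ 2[m₀ - (5/8)(λ/d)] > 0`.
[cite: AizenmanEtAl2004, §2 ("For d = 2 this is true only in the ground state") and Theorem 1]
[cite: KLS1988PRL, Theorem, eqs. (5)–(8)] [cite: LSSY2005, Ch. 11 §11.3 (11.26)–(11.27)] -/
theorem hardCoreLatticeGas_groundState_bec (hd : 2 ≤ d) :
    ∃ lam₀ : ℝ, 0 < lam₀ ∧ ∀ lam : ℝ, 0 ≤ lam → lam < lam₀ →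
      HasEvenTorusLRO (fun L x y => hardCoreGroundODLRO (d := d) L lam x y) := by
  have hd1 : 1 ≤ d := by omega
  have hd0 : (0 : ℝ) < d := by exact_mod_cast (show 0 < d by omega)
  -- the eventual bound on the KLS Riemann sums
  obtain ⟨ρ, hρlt, hρev⟩ := klsRiemannSum_eventually_le d hd
  set ρ' : ℝ := max ρ 0 with hρ'_def
  have hρ'0 : 0 ≤ ρ' := le_max_right _ _
  have hρ'lt : ρ' < Real.sqrt 2 / 2 := max_lt hρlt (by positivity)
  have h2pos : (0 : ℝ) < Real.sqrt 2 := by positivity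
  have h22 : Real.sqrt 2 * Real.sqrt 2 = 2 := Real.mul_self_sqrt (by norm_num)
  have hρ'1 : Real.sqrt 2 * ρ' < 1 := by nlinarith
  have hsqrt2 : Real.sqrt 2 < 2 := by
    rw [Real.sqrt_lt' (by norm_num)]; norm_num
  have hρ'le1 : ρ' ≤ 1 := by nlinarith
  -- the margin at `λ = 0`
  set m₀ : ℝ := (1 - Real.sqrt 2 * ρ') / 8 with hm₀_def
  have hm₀ : 0 < m₀ := by rw [hm₀_def]; linarith
  refine ⟨min ((d : ℝ) / 8) (d * m₀ / 2), lt_min (by positivity) (by positivity), ?_⟩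
  intro lam hlam hlamlt
  have hlam8 : lam / d < 1 / 8 := by
    rw [div_lt_iff₀ hd0]
    have := lt_of_lt_of_le hlamlt (min_le_left _ _)
    linarith
  have hlamm : lam / d < m₀ / 2 := by
    rw [div_lt_iff₀ hd0]
    have := lt_of_lt_of_le hlamlt (min_le_right _ _)
    linarith
  have hlamd : 0 ≤ lam / d := by positivity
  set m₁ : ℝ := m₀ - 5 / 8 * (lam / d) with hm₁_def
  have hm₁ : 0 < m₁ := by rw [hm₁_def]; linarith
  rw [hasEvenTorusLRO_iff]
  have h2k : Tendsto (fun k : ℕ => 2 * k) atTop atTop :=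
    tendsto_atTop_atTop.2 fun b => ⟨b, fun k hk => by omega⟩
  have hRk : ∀ᶠ k : ℕ in atTop, klsRiemannSum d (2 * k) ≤ ρ' :=
    (h2k.eventually hρev).mono fun k hk => hk.trans (le_max_left _ _)
  have hev : ∀ᶠ k : ℕ in atTop, 2 * m₁ ≤
      (∑ x ∈ halfOpenBox d (2 * k), ∑ y ∈ halfOpenBox d (2 * k),
          torusPullback (fun L x y => hardCoreGroundODLRO (d := d) L lam x y) (2 * k) x y) /
        ((halfOpenBox d (2 * k)).card : ℝ) ^ 2 := by
    filter_upwards [hRk, eventually_ge_atTop 2] with k hk hk2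
    haveI : NeZero (2 * k) := ⟨by omega⟩
    rw [hardCoreGround_lroSeq_eq lam k]
    set R := klsRiemannSum d (2 * k) with hR_def
    have hR0 : 0 ≤ R := klsRiemannSum_nonneg _ _
    have hR1 : R ≤ 1 := hk.trans hρ'le1
    have hfloor := hardCoreLatticeGas_ground_lro_ge_of_klsRiemannSum hd1 hk2 hlam (by linarith) hR1
    have hlam4 : lam / (4 * d) = (lam / d) / 4 := by rw [div_div, mul_comm]
    rw [hlam4] at hfloor
    -- `½ R √(1/8 + ¾ λ/d) ≤ √2 ρ'/8 + (3/8)(λ/d)`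
    have hsqrt : Real.sqrt (1 / 8 + 3 / 4 * (lam / d)) ≤
        Real.sqrt 2 / 4 + Real.sqrt 2 * (3 / 4 * (lam / d)) :=
      sqrt_one_eighth_add_le (by positivity)
    have hRs : 1 / 2 * Real.sqrt (1 / 8 + 3 / 4 * (lam / d)) * R ≤
        Real.sqrt 2 * ρ' / 8 + 3 / 8 * (lam / d) := by
      have h1 : 1 / 2 * Real.sqrt (1 / 8 + 3 / 4 * (lam / d)) * R ≤
          1 / 2 * (Real.sqrt 2 / 4 + Real.sqrt 2 * (3 / 4 * (lam / d))) * ρ' :=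
        mul_le_mul (mul_le_mul_of_nonneg_left hsqrt (by norm_num)) hk hR0 (by positivity)
      have h2 : (Real.sqrt 2 * ρ') * (3 / 4 * (lam / d)) ≤ 1 * (3 / 4 * (lam / d)) :=
        mul_le_mul_of_nonneg_right hρ'1.le (by positivity)
      have h3 : 1 / 2 * (Real.sqrt 2 / 4 + Real.sqrt 2 * (3 / 4 * (lam / d))) * ρ' =
          Real.sqrt 2 * ρ' / 8 + (Real.sqrt 2 * ρ') * (3 / 4 * (lam / d)) / 2 := by ring
      linarith
    have key : 2 * m₁ ≤ 2 * ((1 / 8 - lam / d / 4) - 1 / 2 * Real.sqrt (1 / 8 + 3 / 4 * (lam / d)) * R) := by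
      rw [hm₁_def, hm₀_def]
      linarith
    exact key.trans (by linarith [hfloor])
  exact (mul_pos two_pos hm₁).trans_le
    (le_liminf_of_le (isCoboundedUnder_ge_of_le atTop fun k => hardCoreGround_lroSeq_le lam k) hev)

/-- **THE TWO-DIMENSIONAL GROUND STATE HAS BOSE–EINSTEIN CONDENSATION FOR `0 ≤ λ ≤ 1/40`**, with an
explicit floor: eventually in `L = 2k`, `|Λ|⁻²Σ_{x,y}γ_∞(x,y) ≥ 1/250` (from §3 with the tree's
certified `R_L(2) ≤ 0.651`: `(1/8 - λ/8) - 0.3255·(1/8 + 3λ/8)^{1/2} ≥ 1/500` on `[0, 1/40]`).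
This is the `d = 2` assertion of the source's §2, at `T = 0`; at every `T > 0` it fails
(`MerminWagner.hardCoreLatticeGas_not_hasEvenTorusLRO`).
[cite: AizenmanEtAl2004, §2 ("For d = 2 this is true only in the ground state") and Theorem 1]
[cite: KLS1988PRL, Theorem (d = 2, S = ½)] -/
theorem hardCoreLatticeGas_groundState_lroSeq_ge_two {lam : ℝ} (hlam : 0 ≤ lam) (hlam' : lam ≤ 1 / 40) :
    ∀ᶠ k : ℕ in atTop, (1 / 250 : ℝ) ≤
      (∑ x ∈ halfOpenBox 2 (2 * k), ∑ y ∈ halfOpenBox 2 (2 * k),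
          torusPullback (fun L x y => hardCoreGroundODLRO (d := 2) L lam x y) (2 * k) x y) /
        ((halfOpenBox 2 (2 * k)).card : ℝ) ^ 2 := by
  have h2k : Tendsto (fun k : ℕ => 2 * k) atTop atTop :=
    tendsto_atTop_atTop.2 fun b => ⟨b, fun k hk => by omega⟩
  have hRk : ∀ᶠ k : ℕ in atTop, klsRiemannSum 2 (2 * k) ≤ 651 / 1000 :=
    h2k.eventually klsRiemannSum_two_eventually_le
  filter_upwards [hRk, eventually_ge_atTop 2] with k hk hk2
  haveI : NeZero (2 * k) := ⟨by omega⟩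
  rw [hardCoreGround_lroSeq_eq lam k]
  set R := klsRiemannSum 2 (2 * k) with hR_def
  have hR0 : 0 ≤ R := klsRiemannSum_nonneg _ _
  have hfloor := hardCoreLatticeGas_ground_lro_ge_of_klsRiemannSum (d := 2) (by norm_num) hk2 hlam
    (by norm_num at hlam' ⊢; linarith) (by linarith)
  -- numerics: `(1/8 - λ/8) - ½ R √(1/8 + 3λ/8) ≥ 1/500`
  have hs : (1 / 8 - lam / (4 * (2 : ℕ)) : ℝ) ≥ 39 / 320 := by norm_num; linarith
  have hrad : (1 / 8 + 3 / 4 * (lam / (2 : ℕ)) : ℝ) ≤ 43 / 320 := by norm_num; linarith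
  have hsq : Real.sqrt (1 / 8 + 3 / 4 * (lam / (2 : ℕ))) ≤ 3666 / 10000 := by
    refine (Real.sqrt_le_sqrt hrad).trans ?_
    rw [Real.sqrt_le_left (by norm_num)]
    norm_num
  have hprod : 1 / 2 * Real.sqrt (1 / 8 + 3 / 4 * (lam / (2 : ℕ))) * R ≤
      1 / 2 * (3666 / 10000) * (651 / 1000) :=
    mul_le_mul (mul_le_mul_of_nonneg_left hsq (by norm_num)) hk hR0 (by positivity)
  have hnum : (1 / 500 : ℝ) ≤ (1 / 8 - lam / (4 * (2 : ℕ))) -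
      1 / 2 * Real.sqrt (1 / 8 + 3 / 4 * (lam / (2 : ℕ))) * R := by
    norm_num at hs hprod ⊢
    linarith
  linarith [hfloor, hnum]

/-- **`d = 2`, `0 ≤ λ ≤ 1/40`: ground-state off-diagonal long-range order** (`HasEvenTorusLRO` of the
ground-state density matrix; liminf `≥ 1/250`). [cite: AizenmanEtAl2004, §2 and Theorem 1]
[cite: KLS1988PRL, Theorem (d = 2, S = ½)] -/
theorem hardCoreLatticeGas_groundState_bec_two {lam : ℝ} (hlam : 0 ≤ lam) (hlam' : lam ≤ 1 / 40) :
    HasEvenTorusLRO (fun L x y => hardCoreGroundODLRO (d := 2) L lam x y) := by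
  rw [hasEvenTorusLRO_iff]
  exact lt_of_lt_of_le (by norm_num : (0 : ℝ) < 1 / 250)
    (le_liminf_of_le (isCoboundedUnder_ge_of_le atTop fun k => hardCoreGround_lroSeq_le lam k)
      (hardCoreLatticeGas_groundState_lroSeq_ge_two hlam hlam'))

/-- **The ground-vector form in `d = 2`**: for `0 ≤ λ ≤ 1/40` there is `k₀` such that on every even
torus of side `2k ≥ 2k₀`, every normalised ground vector `Φ` of `hardCoreLatticeGas 2 (2k) λ` has
`Σ_{x,y}Re⟨Φ,(S¹_xS¹_y + S²_xS²_y)Φ⟩ ≥ |Λ|²/500` (`|Λ| = (2k)²`) — "`⟨S⁻_totS⁺_tot⟩ ≥ c'|Λ|²`" in the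
two-dimensional ground state. [cite: AizenmanEtAl2004, §2, Theorem 1 and §4 (first display)] -/
theorem hardCoreLatticeGas_groundState_lro_ge_two {lam : ℝ} (hlam : 0 ≤ lam) (hlam' : lam ≤ 1 / 40) :
    ∃ k₀ : ℕ, ∀ k : ℕ, k₀ ≤ k → ∀ [NeZero (2 * k)],
      ∀ Φ : TensorIndex (TorusSite 2 (2 * k)) 2 → ℂ, Φ ∈ (hardCoreLatticeGas 2 (2 * k) lam).groundSpace →
        star Φ ⬝ᵥ Φ = 1 →
        ((((2 * k : ℕ) : ℝ)) ^ 2) ^ 2 / 500 ≤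
          ∑ x : TorusSite 2 (2 * k), ∑ y : TorusSite 2 (2 * k),
            (star Φ ⬝ᵥ ((siteSpin 1 x 0 * siteSpin 1 y 0 + siteSpin 1 x 1 * siteSpin 1 y 1) *ᵥ Φ)).re := by
  have h2k : Tendsto (fun k : ℕ => 2 * k) atTop atTop :=
    tendsto_atTop_atTop.2 fun b => ⟨b, fun k hk => by omega⟩
  have hRk : ∀ᶠ k : ℕ in atTop, klsRiemannSum 2 (2 * k) ≤ 651 / 1000 :=
    h2k.eventually klsRiemannSum_two_eventually_le
  obtain ⟨k₀, hk₀⟩ := Filter.eventually_atTop.1 (hRk.and (eventually_ge_atTop 2))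
  refine ⟨k₀, fun k hk _ Φ hΦ hΦ1 => ?_⟩
  obtain ⟨hR, hk2⟩ := hk₀ k hk
  set R := klsRiemannSum 2 (2 * k) with hR_def
  have hR0 : 0 ≤ R := klsRiemannSum_nonneg _ _
  have h := hardCoreLatticeGas_ground_dotProduct_ge_of_klsRiemannSum (d := 2) (by norm_num) hk2 hlam
    (by norm_num at hlam' ⊢; linarith) (by linarith) hΦ hΦ1
  have hs : (1 / 8 - lam / (4 * (2 : ℕ)) : ℝ) ≥ 39 / 320 := by norm_num; linarith
  have hrad : (1 / 8 + 3 / 4 * (lam / (2 : ℕ)) : ℝ) ≤ 43 / 320 := by norm_num; linarith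
  have hsq : Real.sqrt (1 / 8 + 3 / 4 * (lam / (2 : ℕ))) ≤ 3666 / 10000 := by
    refine (Real.sqrt_le_sqrt hrad).trans ?_
    rw [Real.sqrt_le_left (by norm_num)]
    norm_num
  have hprod : 1 / 2 * Real.sqrt (1 / 8 + 3 / 4 * (lam / (2 : ℕ))) * R ≤
      1 / 2 * (3666 / 10000) * (651 / 1000) :=
    mul_le_mul (mul_le_mul_of_nonneg_left hsq (by norm_num)) hR hR0 (by positivity)
  have hnum : (1 / 500 : ℝ) ≤ (1 / 8 - lam / (4 * (2 : ℕ))) -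
      1 / 2 * Real.sqrt (1 / 8 + 3 / 4 * (lam / (2 : ℕ))) * R := by
    norm_num at hs hprod ⊢
    linarith
  have hN0 : (0 : ℝ) ≤ ((((2 * k : ℕ) : ℝ)) ^ 2) ^ 2 := by positivity
  have hstep : ((((2 * k : ℕ) : ℝ)) ^ 2) ^ 2 / 500 ≤ 2 * ((((2 * k : ℕ) : ℝ)) ^ 2) ^ 2 *
      ((1 / 8 - lam / (4 * (2 : ℕ))) - 1 / 2 * Real.sqrt (1 / 8 + 3 / 4 * (lam / (2 : ℕ))) * R) := by
    have := mul_le_mul_of_nonneg_left hnum hN0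
    linarith
  exact hstep.trans h

end BEC

/-! ### §5 The two-dimensional dichotomy: order at `T = 0`, none at `T > 0` -/

section Dichotomy

/-- **"For `d = 2` this is true only in the ground state."** For the two-dimensional hard-core
lattice gas at half filling with staggered field `0 ≤ λ ≤ 1/40`: the GROUND STATES of the even tori
have off-diagonal long-range order (Bose–Einstein condensation; reflection positivity at `β = ∞`),
while for EVERY `β ≥ 0` the Gibbs states have none (Koma–Tasaki's McBryan–Spencer bound, uniformly
in `λ`). [cite: AizenmanEtAl2004, §2 and Theorem 1] [cite: KomaTasakiPRL1992, bound (4), footnote 11]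
[cite: KLS1988PRL, Theorem] -/
theorem hardCoreLatticeGas_two_groundState_order_and_thermal_disorder {lam : ℝ} (hlam : 0 ≤ lam)
    (hlam' : lam ≤ 1 / 40) :
    HasEvenTorusLRO (fun L x y => hardCoreGroundODLRO (d := 2) L lam x y) ∧
      ∀ β : ℝ, 0 ≤ β → ¬ HasEvenTorusLRO (fun L x y => hardCoreODLRO (d := 2) β L lam x y) :=
  ⟨hardCoreLatticeGas_groundState_bec_two hlam hlam',
    fun _ hβ => MerminWagner.hardCoreLatticeGas_not_hasEvenTorusLRO (Or.inr rfl) lam hβ⟩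

/-- The same dichotomy stated through the `β → ∞` limit: the ground-state kernel with LRO is the
pointwise limit of the thermal kernels without LRO (so `HasEvenTorusLRO` is not preserved under this
limit — the order of the limits `β → ∞`, `Λ ↗ ℤ²` matters). [cite: AizenmanEtAl2004, §2]
[cite: KomaTasakiPRL1992, footnote 11] -/
theorem hardCoreLatticeGas_two_lro_limit_exchange {lam : ℝ} (hlam : 0 ≤ lam) (hlam' : lam ≤ 1 / 40) :
    (∀ (L : ℕ) [NeZero L] (x y : TorusSite 2 L),
        Tendsto (fun β : ℝ => hardCoreODLRO (d := 2) β L lam x y) atTop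
          (𝓝 (hardCoreGroundODLRO L lam x y))) ∧
      (∀ β : ℝ, 0 ≤ β → ¬ HasEvenTorusLRO (fun L x y => hardCoreODLRO (d := 2) β L lam x y)) ∧
      HasEvenTorusLRO (fun L x y => hardCoreGroundODLRO (d := 2) L lam x y) :=
  ⟨fun L _ x y => tendsto_hardCoreODLRO_atTop L lam x y,
    fun _ hβ => MerminWagner.hardCoreLatticeGas_not_hasEvenTorusLRO (Or.inr rfl) lam hβ,
    hardCoreLatticeGas_groundState_bec_two hlam hlam'⟩

end Dichotomy


/-! ### §6 Theorem 1, second clause, AT `T = 0`: the ground-state density matrix has exactly one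
eigenvalue above `O(L)`, with CONSTANT eigenvector — exactly, in finite volume -/

section Condensate

open scoped ComplexConjugate

variable (L : ℕ) [NeZero L]

/-- `γ_∞` is symmetric. [cite: AizenmanEtAl2004, Theorem 1 (proof)] -/
theorem hardCoreGroundODLRO_symm (lam : ℝ) (x y : TorusSite d L) :
    hardCoreGroundODLRO L lam x y = hardCoreGroundODLRO L lam y x := by
  refine tendsto_nhds_unique (tendsto_hardCoreODLRO_atTop L lam x y) ?_
  have h : (fun β : ℝ => hardCoreODLRO (d := d) β L lam x y) = fun β => hardCoreODLRO β L lam y x :=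
    funext fun β => by rw [hardCoreODLRO_eq_add, hardCoreODLRO_eq_add, hcCorr_symm 0, hcCorr_symm 1]
  rw [h]
  exact tendsto_hardCoreODLRO_atTop L lam y x

/-- **`γ_∞` is a convolution kernel** on the even torus: `γ_∞(x,y) = g_∞(y - x)`, `g_∞(z) = γ_∞(0,z)`
(limit of `hardCoreODLRO_eq_kernel`: translation∘flip invariance of `H`).
[cite: AizenmanEtAl2004, Theorem 1 (proof: invariance under translations)] -/
theorem hardCoreGroundODLRO_eq_kernel (hL : Even L) (lam : ℝ) (x y : TorusSite d L) :
    hardCoreGroundODLRO L lam x y = hardCoreGroundODLRO L lam 0 (y - x) := by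
  refine tendsto_nhds_unique (tendsto_hardCoreODLRO_atTop L lam x y) ?_
  have h : (fun β : ℝ => hardCoreODLRO (d := d) β L lam x y) = fun β => hardCoreODLRO β L lam 0 (y - x) :=
    funext fun β => hardCoreODLRO_eq_kernel L hL β lam x y
  rw [h]
  exact tendsto_hardCoreODLRO_atTop L lam 0 (y - x)

/-- The Fourier coefficients of the ground-state kernel are the limits of the thermal ones.
[cite: AizenmanEtAl2004, Theorem 1 (proof)] -/
theorem tendsto_torusFourier_hardCoreODLRO_atTop (lam : ℝ) (k : TorusSite d L) :
    Tendsto (fun β : ℝ => torusFourier (fun z : TorusSite d L => (hardCoreODLRO β L lam 0 z : ℂ)) k) atTop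
      (𝓝 (torusFourier (fun z : TorusSite d L => (hardCoreGroundODLRO L lam 0 z : ℂ)) k)) := by
  unfold torusFourier
  exact tendsto_finsetSum _ fun z _ =>
    ((Complex.continuous_ofReal.tendsto _).comp (tendsto_hardCoreODLRO_atTop L lam 0 z)).mul_const _

/-- **The row sums of `γ_∞` are constant**: `Σ_y γ_∞(x,y) = ĝ_∞(0)`. [cite: AizenmanEtAl2004, Theorem 1 (proof)] -/
theorem sum_hardCoreGroundODLRO_eq (hL : Even L) (lam : ℝ) (x : TorusSite d L) :
    ∑ y, hardCoreGroundODLRO L lam x y =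
      (torusFourier (fun z : TorusSite d L => (hardCoreGroundODLRO L lam 0 z : ℂ)) 0).re := by
  rw [torusFourier_apply_zero, Complex.re_sum]
  simp_rw [Complex.ofReal_re]
  rw [show (∑ y, hardCoreGroundODLRO L lam x y) =
      ∑ y, (fun z => hardCoreGroundODLRO L lam 0 z) (Equiv.subRight x y) from
    sum_congr rfl fun y _ => hardCoreGroundODLRO_eq_kernel L hL lam x y]
  exact Equiv.sum_comp (Equiv.subRight x) _

/-- **The zero mode is the order parameter**: `ĝ_∞(0) = L^{-d}Σ_{x,y}γ_∞(x,y)`.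
[cite: AizenmanEtAl2004, Theorem 1 (proof)] -/
theorem re_torusFourier_hardCoreGroundODLRO_zero (hL : Even L) (lam : ℝ) :
    (torusFourier (fun z : TorusSite d L => (hardCoreGroundODLRO L lam 0 z : ℂ)) 0).re =
      (∑ x : TorusSite d L, ∑ y : TorusSite d L, hardCoreGroundODLRO L lam x y) / (L : ℝ) ^ d := by
  have hLd : (0 : ℝ) < (L : ℝ) ^ d := by
    have : (0 : ℝ) < L := by exact_mod_cast Nat.pos_of_ne_zero (NeZero.ne L)
    positivity
  rw [eq_div_iff hLd.ne', sum_congr rfl fun x _ => sum_hardCoreGroundODLRO_eq L hL lam x, sum_const,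
    card_univ, card_torusSite, nsmul_eq_mul]
  push_cast
  ring

/-- **The constants are eigenvectors of `γ_∞` with the eigenvalue `ĝ_∞(0)`.**
[cite: AizenmanEtAl2004, Theorem 1 (proof)] -/
theorem hardCoreGroundODLRO_mulVec_const (hL : Even L) (lam : ℝ) (c : ℂ) :
    (Matrix.of fun x y : TorusSite d L => (hardCoreGroundODLRO L lam x y : ℂ)) *ᵥ (fun _ => c) =
      ((torusFourier (fun z : TorusSite d L => (hardCoreGroundODLRO L lam 0 z : ℂ)) 0).re : ℂ) •
        (fun _ : TorusSite d L => c) := by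
  funext x
  simp only [Matrix.mulVec, dotProduct, Matrix.of_apply, Pi.smul_apply, smul_eq_mul]
  rw [← sum_mul, ← Complex.ofReal_sum, sum_hardCoreGroundODLRO_eq L hL lam x]

/-- **The ground-state infrared bound on the modes `k ≠ 0`**: on the even torus of side `L ≥ 4`,
`Re ĝ_∞(k) ≤ (L/4)√(d + |λ|/2)` — the `β → ∞` limit of the thermal
`Re ĝ_β(k) ≤ L²/(8β) + (L/4)√(d + |λ|/2)`: the `O(L²)` Duhamel term disappears and only the
Kennedy–Lieb–Shastry square root, `O(L) = o(|Λ|)` in EVERY `d ≥ 2`, survives.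
[cite: AizenmanEtAl2004, eq. (3.6) and Theorem 1 (proof)] [cite: KLS1988PRL, eq. (4)] -/
theorem re_torusFourier_hardCoreGroundODLRO_le (hL : Even L) (h4 : 4 ≤ L) (lam : ℝ)
    {k : TorusSite d L} (hk : k ≠ 0) :
    (torusFourier (fun z : TorusSite d L => (hardCoreGroundODLRO L lam 0 z : ℂ)) k).re ≤
      (L : ℝ) / 4 * Real.sqrt ((d : ℝ) + |lam| / 2) := by
  have hth : ∀ β : ℝ, 0 < β →
      (torusFourier (fun z : TorusSite d L => (hardCoreODLRO β L lam 0 z : ℂ)) k).re ≤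
        (L : ℝ) ^ 2 / (8 * β) + (L : ℝ) / 4 * Real.sqrt ((d : ℝ) + |lam| / 2) :=
    fun β hβ => re_torusFourier_hardCoreODLRO_le L hL h4 hβ lam hk
  have hlim := (Complex.continuous_re.tendsto _).comp (tendsto_torusFourier_hardCoreODLRO_atTop L lam k)
  have hM : Tendsto (fun β : ℝ => (L : ℝ) ^ 2 / (8 * β) + (L : ℝ) / 4 * Real.sqrt ((d : ℝ) + |lam| / 2))
      atTop (𝓝 (0 + (L : ℝ) / 4 * Real.sqrt ((d : ℝ) + |lam| / 2))) := by
    refine Tendsto.add ?_ tendsto_const_nhds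
    exact (tendsto_const_nhds (x := (L : ℝ) ^ 2)).div_atTop
      (Tendsto.const_mul_atTop (by norm_num : (0 : ℝ) < 8) tendsto_id)
  rw [zero_add] at hM
  exact le_of_tendsto_of_tendsto hlim hM (Filter.eventually_atTop.2 ⟨1, fun β hβ => hth β (by linarith)⟩)

/-- The quadratic form of `γ_∞` on the functions orthogonal to the constants is bounded by the
largest nonzero-mode coefficient: `Σφ = 0 ⇒ Re Σ_{x,y} φ_x φ̄_y γ_∞(x,y) ≤ (L/4)√(d + |λ|/2) Σ|φ_x|²`
(limit of the thermal Plancherel bound). [cite: AizenmanEtAl2004, Theorem 1 (proof)] -/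
theorem hardCoreGroundODLRO_quadForm_re_le (hL : Even L) (h4 : 4 ≤ L) (lam : ℝ)
    (φ : TorusSite d L → ℂ) (hφ : ∑ x, φ x = 0) :
    (∑ x, ∑ y, φ x * conj (φ y) * (hardCoreGroundODLRO L lam x y : ℂ)).re ≤
      (L : ℝ) / 4 * Real.sqrt ((d : ℝ) + |lam| / 2) * ∑ x, ‖φ x‖ ^ 2 := by
  set Minf : ℝ := (L : ℝ) / 4 * Real.sqrt ((d : ℝ) + |lam| / 2) with hMinf
  have hth : ∀ β : ℝ, 0 < β →
      (∑ x, ∑ y, φ x * conj (φ y) * (hardCoreODLRO β L lam x y : ℂ)).re ≤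
        ((L : ℝ) ^ 2 / (8 * β) + Minf) * ∑ x, ‖φ x‖ ^ 2 :=
    fun β hβ => hardCoreODLRO_quadForm_re_le L hL β lam
      (fun k hk => re_torusFourier_hardCoreODLRO_le L hL h4 hβ lam hk) φ hφ
  have hlim : Tendsto (fun β : ℝ => (∑ x, ∑ y, φ x * conj (φ y) * (hardCoreODLRO β L lam x y : ℂ)).re)
      atTop (𝓝 ((∑ x, ∑ y, φ x * conj (φ y) * (hardCoreGroundODLRO L lam x y : ℂ)).re)) :=
    (Complex.continuous_re.tendsto _).comp (tendsto_finsetSum _ fun x _ => tendsto_finsetSum _ fun y _ =>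
      ((Complex.continuous_ofReal.tendsto _).comp (tendsto_hardCoreODLRO_atTop L lam x y)).const_mul _)
  have hM : Tendsto (fun β : ℝ => ((L : ℝ) ^ 2 / (8 * β) + Minf) * ∑ x, ‖φ x‖ ^ 2) atTop
      (𝓝 ((0 + Minf) * ∑ x, ‖φ x‖ ^ 2)) := by
    refine (Tendsto.add ?_ tendsto_const_nhds).mul_const _
    exact (tendsto_const_nhds (x := (L : ℝ) ^ 2)).div_atTop
      (Tendsto.const_mul_atTop (by norm_num : (0 : ℝ) < 8) tendsto_id)
  rw [zero_add] at hM
  exact le_of_tendsto_of_tendsto hlim hM (Filter.eventually_atTop.2 ⟨1, fun β hβ => hth β (by linarith)⟩)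

/-- **THE SPECTRAL DICHOTOMY AT `T = 0`** (at most one eigenvalue above `O(L)`): on the even torus of
side `L ≥ 4`, every `d`, every real `λ`, if `γ_∞φ = μφ` with `μ > M_L := (L/4)√(d + |λ|/2)`, then `φ`
is CONSTANT (decompose `φ = aφ₀ + ψ`, `ψ ⊥ φ₀`; constant row/column sums give `γ_∞ψ = μψ`, and
`μ‖ψ‖² = ⟨ψ|γ_∞|ψ⟩ ≤ M_L‖ψ‖²` forces `ψ = 0`) — the proof of `hardCoreODLRO_eigenvector_const`
verbatim with the `T = 0` threshold. [cite: AizenmanEtAl2004, Theorem 1 (proof of the second clause)] -/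
theorem hardCoreGroundODLRO_eigenvector_const (hL : Even L) (h4 : 4 ≤ L) (lam : ℝ)
    {μ : ℝ} {φ : TorusSite d L → ℂ}
    (heig : (Matrix.of fun x y : TorusSite d L => (hardCoreGroundODLRO L lam x y : ℂ)) *ᵥ φ = (μ : ℂ) • φ)
    (hμ : (L : ℝ) / 4 * Real.sqrt ((d : ℝ) + |lam| / 2) < μ) :
    ∀ x y, φ x = φ y := by
  have hLd : (0 : ℝ) < (L : ℝ) ^ d := by
    have : (0 : ℝ) < L := by exact_mod_cast Nat.pos_of_ne_zero (NeZero.ne L)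
    positivity
  have hLC : ((L : ℂ) ^ d) ≠ 0 := by exact_mod_cast hLd.ne'
  have hcardC : (Fintype.card (TorusSite d L) : ℂ) = (L : ℂ) ^ d := by
    rw [card_torusSite]; push_cast; ring
  set G : ℝ := (torusFourier (fun z : TorusSite d L => (hardCoreGroundODLRO L lam 0 z : ℂ)) 0).re with hG
  set M : ℝ := (L : ℝ) / 4 * Real.sqrt ((d : ℝ) + |lam| / 2) with hM
  have hrow : ∀ x, ∑ y, (hardCoreGroundODLRO L lam x y : ℂ) * φ y = (μ : ℂ) * φ x := by
    intro x
    have hx := congrFun heig x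
    simpa only [Matrix.mulVec, dotProduct, Matrix.of_apply, Pi.smul_apply, smul_eq_mul] using hx
  have hrowsum : ∀ x, ∑ y, (hardCoreGroundODLRO L lam x y : ℂ) = (G : ℂ) := fun x => by
    rw [← Complex.ofReal_sum, sum_hardCoreGroundODLRO_eq L hL lam x]
  have hcolsum : ∀ y, ∑ x, (hardCoreGroundODLRO L lam x y : ℂ) = (G : ℂ) := fun y => by
    rw [← Complex.ofReal_sum, sum_congr rfl fun x _ => hardCoreGroundODLRO_symm L lam x y,
      sum_hardCoreGroundODLRO_eq L hL lam y]
  set a : ℂ := (∑ x, φ x) / (L : ℂ) ^ d with ha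
  set ψ : TorusSite d L → ℂ := fun x => φ x - a with hψ
  have hψsum : ∑ x, ψ x = 0 := by
    simp only [hψ, sum_sub_distrib, sum_const, card_univ, nsmul_eq_mul, hcardC]
    rw [ha, mul_div_cancel₀ _ hLC, sub_self]
  have hrowψ : ∀ x, ∑ y, (hardCoreGroundODLRO L lam x y : ℂ) * ψ y = (μ : ℂ) * φ x - a * G := by
    intro x
    simp only [hψ, mul_sub, sum_sub_distrib, hrow x, ← sum_mul, hrowsum x]
    ring
  have haμ : a * ((μ : ℂ) - G) = 0 := by
    have h1 : ∑ x, ∑ y, (hardCoreGroundODLRO L lam x y : ℂ) * ψ y = 0 := by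
      rw [sum_comm]
      simp_rw [← sum_mul, hcolsum, ← mul_sum, hψsum, mul_zero]
    have h2 : ∑ x, ∑ y, (hardCoreGroundODLRO L lam x y : ℂ) * ψ y = (L : ℂ) ^ d * (a * ((μ : ℂ) - G)) := by
      simp_rw [hrowψ]
      rw [sum_sub_distrib, ← mul_sum, sum_const, card_univ, nsmul_eq_mul, hcardC, ha]
      field_simp
    rw [h2] at h1
    exact (mul_eq_zero.mp h1).resolve_left hLC
  have heigψ : ∀ x, ∑ y, (hardCoreGroundODLRO L lam x y : ℂ) * ψ y = (μ : ℂ) * ψ x := by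
    intro x
    rw [hrowψ x]
    simp only [hψ]
    linear_combination haμ
  have hQ : (∑ x, ∑ y, ψ x * conj (ψ y) * (hardCoreGroundODLRO L lam x y : ℂ)).re = μ * ∑ x, ‖ψ x‖ ^ 2 := by
    have h1 : ∑ x, ∑ y, ψ x * conj (ψ y) * (hardCoreGroundODLRO L lam x y : ℂ) =
        ∑ y, conj (ψ y) * ((μ : ℂ) * ψ y) := by
      rw [sum_comm]
      refine sum_congr rfl fun y _ => ?_
      rw [← heigψ y, mul_sum]
      refine sum_congr rfl fun x _ => ?_
      rw [hardCoreGroundODLRO_symm L lam x y]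
      ring
    have h2 : ∀ y, (conj (ψ y) * ((μ : ℂ) * ψ y)).re = μ * ‖ψ y‖ ^ 2 := fun y => by
      rw [show conj (ψ y) * ((μ : ℂ) * ψ y) = (μ : ℂ) * (ψ y * conj (ψ y)) by ring, Complex.mul_conj,
        Complex.normSq_eq_norm_sq, ← Complex.ofReal_mul, Complex.ofReal_re]
    rw [h1, Complex.re_sum, mul_sum]
    exact sum_congr rfl fun y _ => h2 y
  have hbound := hardCoreGroundODLRO_quadForm_re_le L hL h4 lam ψ hψsum
  rw [hQ] at hbound
  have hψ0 : ∑ x, ‖ψ x‖ ^ 2 = 0 := by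
    have hnn : 0 ≤ ∑ x, ‖ψ x‖ ^ 2 := sum_nonneg fun x _ => sq_nonneg _
    nlinarith
  have hψzero : ∀ x, ψ x = 0 := by
    intro x
    have hx := (sum_eq_zero_iff_of_nonneg fun y _ => sq_nonneg ‖ψ y‖).mp hψ0 x (mem_univ x)
    exact norm_eq_zero.mp (pow_eq_zero_iff two_ne_zero |>.mp hx)
  intro x y
  have hx := hψzero x
  have hy := hψzero y
  simp only [hψ, sub_eq_zero] at hx hy
  rw [hx, hy]

/-- Hence a ground-state eigenvalue above `M_L = (L/4)√(d + |λ|/2)` IS the zero mode `ĝ_∞(0)`.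
[cite: AizenmanEtAl2004, Theorem 1 (proof of the second clause)] -/
theorem hardCoreGroundODLRO_eigenvalue_eq_zeroMode (hL : Even L) (h4 : 4 ≤ L) (lam : ℝ)
    {μ : ℝ} {φ : TorusSite d L → ℂ} (hφ : φ ≠ 0)
    (heig : (Matrix.of fun x y : TorusSite d L => (hardCoreGroundODLRO L lam x y : ℂ)) *ᵥ φ = (μ : ℂ) • φ)
    (hμ : (L : ℝ) / 4 * Real.sqrt ((d : ℝ) + |lam| / 2) < μ) :
    μ = (torusFourier (fun z : TorusSite d L => (hardCoreGroundODLRO L lam 0 z : ℂ)) 0).re := by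
  have hconst := hardCoreGroundODLRO_eigenvector_const L hL h4 lam heig hμ
  obtain ⟨x₀, hx₀⟩ : ∃ x, φ x ≠ 0 := by
    by_contra h
    push Not at h
    exact hφ (funext h)
  have hφc : φ = fun _ => φ x₀ := funext fun x => hconst x x₀
  have h := hardCoreGroundODLRO_mulVec_const (d := d) L hL lam (φ x₀)
  rw [← hφc, heig] at h
  have hx := congrFun h x₀
  simp only [Pi.smul_apply, smul_eq_mul] at hx
  exact_mod_cast mul_right_cancel₀ hx₀ hx

/-- … and its eigenvector has `|Σ_x φ(x)|² = |Λ| Σ_x |φ(x)|²` (`|Λ|⁻¹|Σφ|² = 1` for `φ` normalised) —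
the printed "condensate wave function is constant", EXACTLY, in finite volume, at `T = 0`.
[cite: AizenmanEtAl2004, Theorem 1 (second clause)] -/
theorem hardCoreGroundODLRO_eigenvector_norm_sum_sq (hL : Even L) (h4 : 4 ≤ L) (lam : ℝ)
    {μ : ℝ} {φ : TorusSite d L → ℂ}
    (heig : (Matrix.of fun x y : TorusSite d L => (hardCoreGroundODLRO L lam x y : ℂ)) *ᵥ φ = (μ : ℂ) • φ)
    (hμ : (L : ℝ) / 4 * Real.sqrt ((d : ℝ) + |lam| / 2) < μ) :
    ‖∑ x, φ x‖ ^ 2 = (L : ℝ) ^ d * ∑ x, ‖φ x‖ ^ 2 := by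
  have hconst := hardCoreGroundODLRO_eigenvector_const L hL h4 lam heig hμ
  rw [sum_congr rfl fun x (_ : x ∈ univ) => hconst x 0,
    sum_congr rfl fun x (_ : x ∈ univ) => show ‖φ x‖ ^ 2 = ‖φ 0‖ ^ 2 by rw [hconst x 0],
    sum_const, sum_const, card_univ, card_torusSite]
  simp only [nsmul_eq_mul, norm_mul, Complex.norm_natCast]
  push_cast
  ring

/-- **THEOREM 1, SECOND CLAUSE, IN THE TWO-DIMENSIONAL GROUND STATE.** For `d = 2` and
`0 ≤ λ ≤ 1/40` there is `k₀` such that on every torus `Λ = (ℤ/2kℤ)²`, `k ≥ k₀` (`L = 2k`): the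
constants are eigenvectors of the ground-state one-particle density matrix `γ_∞` with the eigenvalue
`ĝ_∞(0) = |Λ|⁻¹Σ_{x,y}γ_∞(x,y) ≥ |Λ|/250` (macroscopic), and EVERY eigenvector `φ ≠ 0` with eigenvalue
`μ > (L/4)√(2 + λ/2)` (`= O(|Λ|^{1/2})`) is constant, with `μ = ĝ_∞(0)` and `|Σφ|² = |Λ|Σ|φ|²` — so
`γ_∞` has EXACTLY ONE eigenvalue above `O(L)`, it is simple, of order `|Λ|`, and the condensate wave
function is constant (the two-dimensional ground-state version of the printed
`lim |Λ|⁻¹|Σφ(x)|² = 1`). [cite: AizenmanEtAl2004, §2 ("For d = 2 this is true only in the ground state") and Theorem 1 (second clause)] -/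
theorem hardCoreLatticeGas_groundState_condensateWaveFunction_const_two {lam : ℝ} (hlam : 0 ≤ lam)
    (hlam' : lam ≤ 1 / 40) :
    ∃ k₀ : ℕ, ∀ k : ℕ, k₀ ≤ k → ∀ [NeZero (2 * k)],
      ((2 * k : ℕ) : ℝ) ^ 2 / 250 ≤
          (torusFourier (fun z : TorusSite 2 (2 * k) => (hardCoreGroundODLRO (2 * k) lam 0 z : ℂ)) 0).re ∧
      (Matrix.of fun x y : TorusSite 2 (2 * k) => (hardCoreGroundODLRO (2 * k) lam x y : ℂ)) *ᵥ
          (fun _ => (1 : ℂ)) =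
        ((torusFourier (fun z : TorusSite 2 (2 * k) => (hardCoreGroundODLRO (2 * k) lam 0 z : ℂ)) 0).re : ℂ) •
          (fun _ : TorusSite 2 (2 * k) => (1 : ℂ)) ∧
      ((2 * k : ℕ) : ℝ) / 4 * Real.sqrt ((2 : ℕ) + |lam| / 2) <
          (torusFourier (fun z : TorusSite 2 (2 * k) => (hardCoreGroundODLRO (2 * k) lam 0 z : ℂ)) 0).re ∧
      ∀ (μ : ℝ) (φ : TorusSite 2 (2 * k) → ℂ), φ ≠ 0 →
        (Matrix.of fun x y : TorusSite 2 (2 * k) => (hardCoreGroundODLRO (2 * k) lam x y : ℂ)) *ᵥ φ =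
          (μ : ℂ) • φ →
        ((2 * k : ℕ) : ℝ) / 4 * Real.sqrt ((2 : ℕ) + |lam| / 2) < μ →
          (∀ x y, φ x = φ y) ∧
            μ = (torusFourier (fun z : TorusSite 2 (2 * k) => (hardCoreGroundODLRO (2 * k) lam 0 z : ℂ)) 0).re ∧
            ‖∑ x, φ x‖ ^ 2 = ((2 * k : ℕ) : ℝ) ^ 2 * ∑ x, ‖φ x‖ ^ 2 := by
  -- the zero mode is macroscopic eventually (§4), and `(L/4)√(2 + λ/2) < L²/250` for `L ≥ 100`
  obtain ⟨k₁, hk₁⟩ := Filter.eventually_atTop.1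
    ((hardCoreLatticeGas_groundState_lroSeq_ge_two hlam hlam').and (eventually_ge_atTop 50))
  refine ⟨k₁, fun k hk _ => ?_⟩
  obtain ⟨hlro, hk50⟩ := hk₁ k hk
  have hL : Even (2 * k) := even_two_mul k
  have h4 : 4 ≤ 2 * k := by omega
  rw [hardCoreGround_lroSeq_eq lam k] at hlro
  set N : ℝ := (((2 * k : ℕ) : ℝ)) ^ 2 with hN
  have hNpos : 0 < N := by positivity
  -- `ĝ_∞(0) = N · (|Λ|⁻²Σγ_∞) ≥ N/250`
  have hzero : N / 250 ≤
      (torusFourier (fun z : TorusSite 2 (2 * k) => (hardCoreGroundODLRO (2 * k) lam 0 z : ℂ)) 0).re := by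
    rw [re_torusFourier_hardCoreGroundODLRO_zero (2 * k) hL lam]
    have hsum : ∑ x : TorusSite 2 (2 * k), ∑ y : TorusSite 2 (2 * k), hardCoreGroundODLRO (2 * k) lam x y =
        2 * ∑ x : TorusSite 2 (2 * k), ∑ y : TorusSite 2 (2 * k), hcGroundCorr 0 (2 * k) lam x y := by
      simp only [hardCoreGroundODLRO_eq_two_mul, ← mul_sum]
    rw [hsum, le_div_iff₀ hNpos]
    have h := mul_le_mul_of_nonneg_left hlro (le_of_lt (mul_pos hNpos hNpos))
    have hNN : N * N * (2 * ((∑ x : TorusSite 2 (2 * k), ∑ y : TorusSite 2 (2 * k),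
        hcGroundCorr 0 (2 * k) lam x y) / N ^ 2)) =
        2 * ∑ x : TorusSite 2 (2 * k), ∑ y : TorusSite 2 (2 * k), hcGroundCorr 0 (2 * k) lam x y := by
      field_simp
    rw [hNN] at h
    linarith
  -- the threshold `M_L = (L/4)√(2 + λ/2) ≤ (3/8)L < L²/250`
  have hM : ((2 * k : ℕ) : ℝ) / 4 * Real.sqrt ((2 : ℕ) + |lam| / 2) < N / 250 := by
    rw [abs_of_nonneg hlam]
    have hsq : Real.sqrt ((2 : ℕ) + lam / 2) ≤ 3 / 2 := by
      rw [Real.sqrt_le_left (by norm_num)]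
      push_cast
      linarith
    have hLr : (100 : ℝ) ≤ ((2 * k : ℕ) : ℝ) := by exact_mod_cast (show 100 ≤ 2 * k by omega)
    have h1 : ((2 * k : ℕ) : ℝ) / 4 * Real.sqrt ((2 : ℕ) + lam / 2) ≤ ((2 * k : ℕ) : ℝ) / 4 * (3 / 2) :=
      mul_le_mul_of_nonneg_left hsq (by positivity)
    have h2 : ((2 * k : ℕ) : ℝ) / 4 * (3 / 2) < N / 250 := by
      rw [hN]; nlinarith
    exact h1.trans_lt h2
  have hgap := hM.trans_le hzero
  refine ⟨hzero, hardCoreGroundODLRO_mulVec_const (2 * k) hL lam 1, hgap, fun μ φ hφ heig hμ => ?_⟩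
  exact ⟨hardCoreGroundODLRO_eigenvector_const (2 * k) hL h4 lam heig hμ,
    hardCoreGroundODLRO_eigenvalue_eq_zeroMode (2 * k) hL h4 lam hφ heig hμ,
    hardCoreGroundODLRO_eigenvector_norm_sum_sq (2 * k) hL h4 lam heig hμ⟩

end Condensate


/-! ### §7 Theorem 1, second clause, at `T = 0` in EVERY dimension `d ≥ 2` (small staggered field) -/

section CondensateAllDimensions

/-- Lower a priori bound of the ground-state LRO sequence: `|Λ|⁻²Σ_{x,y}γ_∞ ≥ -½`.
[cite: LSSY2005, Ch. 11 §11.3 (after (11.27))] -/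
theorem hardCoreGround_lroSeq_ge (lam : ℝ) (k : ℕ) :
    -(1 / 2 : ℝ) ≤ (∑ x ∈ halfOpenBox d (2 * k), ∑ y ∈ halfOpenBox d (2 * k),
        torusPullback (fun L x y => hardCoreGroundODLRO (d := d) L lam x y) (2 * k) x y) /
        ((halfOpenBox d (2 * k)).card : ℝ) ^ 2 := by
  rcases Nat.eq_zero_or_pos ((halfOpenBox d (2 * k)).card) with h0 | hpos
  · rw [h0]; norm_num
  have hc : (0 : ℝ) < ((halfOpenBox d (2 * k)).card : ℝ) ^ 2 := by positivity
  rw [le_div_iff₀ hc]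
  have hb : ∀ x y : Site d, -(1 / 2 : ℝ) ≤ torusPullback (fun L x y => hardCoreGroundODLRO (d := d) L lam x y)
      (2 * k) x y := by
    intro x y
    rw [torusPullback_apply]
    exact neg_le_of_abs_le (abs_hardCoreGroundODLRO_le _ _ _ _)
  calc -(1 / 2 : ℝ) * ((halfOpenBox d (2 * k)).card : ℝ) ^ 2
      = ∑ x ∈ halfOpenBox d (2 * k), ∑ y ∈ halfOpenBox d (2 * k), (-(1 / 2 : ℝ)) := by
        simp only [sum_const, nsmul_eq_mul]; ring
    _ ≤ _ := sum_le_sum fun x _ => sum_le_sum fun y _ => hb x y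

/-- **THEOREM 1, SECOND CLAUSE, IN THE GROUND STATE, EVERY `d ≥ 2`.** For every `d ≥ 2` there is
`λ₀ > 0` such that for `0 ≤ λ < λ₀` there are `m > 0` and `k₀` with: on every torus
`Λ = (ℤ/2kℤ)^d`, `k ≥ k₀` (`L = 2k`), the constants are eigenvectors of the ground-state density matrix
`γ_∞` with the eigenvalue `ĝ_∞(0) ≥ m|Λ|`, the threshold `M_L = (L/4)√(d + λ/2)` (`= O(|Λ|^{1/d})`) is
below `ĝ_∞(0)`, and EVERY eigenvector `φ ≠ 0` with eigenvalue `μ > M_L` is constant, with `μ = ĝ_∞(0)`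
and `|Σφ|² = |Λ|Σ|φ|²` — exactly one eigenvalue above `O(|Λ|^{1/d})`, simple, macroscopic, constant
condensate wave function (the source's "`2^d const|Λ|^{2/d} ≪ |Λ|`" becomes `O(|Λ|^{1/d}) ≪ |Λ|` at
`T = 0`, valid also in `d = 2`). [cite: AizenmanEtAl2004, §2 and Theorem 1 (second clause, proof)]
[cite: KLS1988PRL, Theorem] -/
theorem hardCoreLatticeGas_groundState_condensateWaveFunction_const (hd : 2 ≤ d) :
    ∃ lam₀ : ℝ, 0 < lam₀ ∧ ∀ lam : ℝ, 0 ≤ lam → lam < lam₀ →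
      ∃ m : ℝ, 0 < m ∧ ∃ k₀ : ℕ, ∀ k : ℕ, k₀ ≤ k → ∀ [NeZero (2 * k)],
        m * (((2 * k : ℕ) : ℝ)) ^ d ≤
            (torusFourier (fun z : TorusSite d (2 * k) => (hardCoreGroundODLRO (2 * k) lam 0 z : ℂ)) 0).re ∧
        (Matrix.of fun x y : TorusSite d (2 * k) => (hardCoreGroundODLRO (2 * k) lam x y : ℂ)) *ᵥ
            (fun _ => (1 : ℂ)) =
          ((torusFourier (fun z : TorusSite d (2 * k) => (hardCoreGroundODLRO (2 * k) lam 0 z : ℂ)) 0).re : ℂ) •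
            (fun _ : TorusSite d (2 * k) => (1 : ℂ)) ∧
        ((2 * k : ℕ) : ℝ) / 4 * Real.sqrt ((d : ℝ) + |lam| / 2) <
            (torusFourier (fun z : TorusSite d (2 * k) => (hardCoreGroundODLRO (2 * k) lam 0 z : ℂ)) 0).re ∧
        ∀ (μ : ℝ) (φ : TorusSite d (2 * k) → ℂ), φ ≠ 0 →
          (Matrix.of fun x y : TorusSite d (2 * k) => (hardCoreGroundODLRO (2 * k) lam x y : ℂ)) *ᵥ φ =
            (μ : ℂ) • φ →
          ((2 * k : ℕ) : ℝ) / 4 * Real.sqrt ((d : ℝ) + |lam| / 2) < μ →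
            (∀ x y, φ x = φ y) ∧
              μ = (torusFourier (fun z : TorusSite d (2 * k) => (hardCoreGroundODLRO (2 * k) lam 0 z : ℂ)) 0).re ∧
              ‖∑ x, φ x‖ ^ 2 = ((2 * k : ℕ) : ℝ) ^ d * ∑ x, ‖φ x‖ ^ 2 := by
  obtain ⟨lam₀, hlam₀, hbec⟩ := hardCoreLatticeGas_groundState_bec (d := d) hd
  refine ⟨lam₀, hlam₀, fun lam hlam hlamlt => ?_⟩
  have hlro := hbec lam hlam hlamlt
  rw [hasEvenTorusLRO_iff] at hlro
  -- a positive eventual floor `m` on the LRO sequence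
  set ℓ : ℝ := liminf (fun k : ℕ => (∑ x ∈ halfOpenBox d (2 * k), ∑ y ∈ halfOpenBox d (2 * k),
      torusPullback (fun L x y => hardCoreGroundODLRO (d := d) L lam x y) (2 * k) x y) /
      ((halfOpenBox d (2 * k)).card : ℝ) ^ 2) atTop with hℓ
  set m : ℝ := ℓ / 4 with hm
  have hm0 : 0 < m := by rw [hm]; linarith
  have hmℓ : 2 * m < ℓ := by rw [hm]; linarith
  have hev : ∀ᶠ k : ℕ in atTop, 2 * m < (∑ x ∈ halfOpenBox d (2 * k), ∑ y ∈ halfOpenBox d (2 * k),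
      torusPullback (fun L x y => hardCoreGroundODLRO (d := d) L lam x y) (2 * k) x y) /
      ((halfOpenBox d (2 * k)).card : ℝ) ^ 2 :=
    eventually_lt_of_lt_liminf hmℓ (isBoundedUnder_of ⟨-(1 / 2 : ℝ), fun k => hardCoreGround_lroSeq_ge lam k⟩)
  -- the threshold is eventually below `m |Λ|`: `(L/4)√(d + λ/2) < m L² ≤ m L^d`
  set C : ℝ := Real.sqrt ((d : ℝ) + |lam| / 2) with hC
  have hC0 : 0 ≤ C := Real.sqrt_nonneg _
  have hevL : ∀ᶠ k : ℕ in atTop, C / (4 * m) < ((2 * k : ℕ) : ℝ) := by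
    have h2k : Tendsto (fun k : ℕ => ((2 * k : ℕ) : ℝ)) atTop atTop := by
      refine tendsto_natCast_atTop_atTop.comp ?_
      exact tendsto_atTop_atTop.2 fun b => ⟨b, fun k hk => by omega⟩
    exact h2k.eventually (eventually_gt_atTop _)
  obtain ⟨k₀, hk₀⟩ := Filter.eventually_atTop.1 ((hev.and hevL).and (eventually_ge_atTop 2))
  refine ⟨m, hm0, k₀, fun k hk _ => ?_⟩
  obtain ⟨⟨hlro_k, hLk⟩, hk2⟩ := hk₀ k hk
  have hL : Even (2 * k) := even_two_mul k
  have h4 : 4 ≤ 2 * k := by omega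
  rw [hardCoreGround_lroSeq_eq lam k] at hlro_k
  set N : ℝ := (((2 * k : ℕ) : ℝ)) ^ d with hN
  have hLpos : (0 : ℝ) < ((2 * k : ℕ) : ℝ) := by exact_mod_cast (show 0 < 2 * k by omega)
  have hNpos : 0 < N := by positivity
  -- `ĝ_∞(0) = N · lroSeq ≥ 2 m N`
  have hzero : 2 * m * N ≤
      (torusFourier (fun z : TorusSite d (2 * k) => (hardCoreGroundODLRO (2 * k) lam 0 z : ℂ)) 0).re := by
    rw [re_torusFourier_hardCoreGroundODLRO_zero (2 * k) hL lam]
    have hsum : ∑ x : TorusSite d (2 * k), ∑ y : TorusSite d (2 * k), hardCoreGroundODLRO (2 * k) lam x y =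
        2 * ∑ x : TorusSite d (2 * k), ∑ y : TorusSite d (2 * k), hcGroundCorr 0 (2 * k) lam x y := by
      simp only [hardCoreGroundODLRO_eq_two_mul, ← mul_sum]
    rw [hsum, le_div_iff₀ hNpos]
    have h := mul_le_mul_of_nonneg_left hlro_k.le (le_of_lt (mul_pos hNpos hNpos))
    have hNN : N * N * (2 * ((∑ x : TorusSite d (2 * k), ∑ y : TorusSite d (2 * k),
        hcGroundCorr 0 (2 * k) lam x y) / N ^ 2)) =
        2 * ∑ x : TorusSite d (2 * k), ∑ y : TorusSite d (2 * k), hcGroundCorr 0 (2 * k) lam x y := by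
      field_simp
    rw [hNN] at h
    linarith
  have hmN : m * N ≤ 2 * m * N := by nlinarith
  -- `M_L < m N`
  have hM : ((2 * k : ℕ) : ℝ) / 4 * C < m * N := by
    have h1 : ((2 * k : ℕ) : ℝ) / 4 * C < m * ((2 * k : ℕ) : ℝ) ^ 2 := by
      rw [div_lt_iff₀ (by positivity)] at hLk
      nlinarith
    have h2 : ((2 * k : ℕ) : ℝ) ^ 2 ≤ N := by
      rw [hN]
      exact pow_le_pow_right₀ (by exact_mod_cast (show 1 ≤ 2 * k by omega)) hd
    nlinarith
  have hgap := (hM.trans_le hmN).trans_le hzero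
  refine ⟨hmN.trans hzero, hardCoreGroundODLRO_mulVec_const (2 * k) hL lam 1, hgap,
    fun μ φ hφ heig hμ => ?_⟩
  exact ⟨hardCoreGroundODLRO_eigenvector_const (2 * k) hL h4 lam heig hμ,
    hardCoreGroundODLRO_eigenvalue_eq_zeroMode (2 * k) hL h4 lam hφ heig hμ,
    hardCoreGroundODLRO_eigenvector_norm_sum_sq (2 * k) hL h4 lam heig hμ⟩

end CondensateAllDimensions

end Literature.MathematicalPhysics.QuantumLattice

end
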